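import Mathlib
import Summits.Ventures.HodgeRepro.Tier4.Line4.RatioReduce
import Summits.Ventures.HodgeRepro.Tier4.Line4.LevelIndexCount
import Summits.Ventures.HodgeRepro.Tier4.Line4.FoldedUnfolded
import Summits.Ventures.HodgeRepro.Tier4.Line4.CentralScalars

/-!
# Tier4/Line4/RatioDischarge — (S-RATIO) from the COUNT-form index bound and the `T_f`-projection comparison: the
projection set is measurable, and the glue's `hratio` follows by name modulo the display `TProjectionComparisonAlong`

Blind re-derivation cell `pub-hodge-repro`, Tier 4 «prove the step» (README §9–§10), seat t4-L2-p1 (gen 3; the (β) item owed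
at S15442 for `RatioReduce` (p707820), and the discharge announced at S15464 — the (α) cover is L4-p2's count-form index bound
`exists_finset_cover_levelDoubleCoset` (LevelIndexCount p708124), bound BY NAME, not restated).  Tree path
`lean/Summits/Ventures/HodgeRepro/Tier4/Line4/RatioDischarge.lean`.  Imports `Line4/RatioReduce`, `Line4/LevelIndexCount`,
`Line4/FoldedUnfolded` (x2's connector `suppMeasureFolded_le_suppMeasure`, p707234), `Line4/CentralScalars`
(`ofFinPart_mem_finitePart'`).  Mathlib-level; no literature; no `def`.

(β) **`measurableSet_projSet`** — `N ≠ 0`: `projSet γ = {b : fibreSet b ≠ ∅}` is `F_σ`.  `T′_f` is σ-compact (locally compact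
and second countable), and for a compact `K ⊆ T′_f` the piece `{b | ∃ b′ ∈ K, b⁻¹ γ_f b′ ∈ K(N) γ₀,f K(N)}` is closed: it is
the preimage under the coercion `T_f → G(𝔸)` of the compact image of `K ×ˢ (K(N) γ₀,f K(N))` under `(b′, d) ↦ γ_f b′ d⁻¹`
(`isClosed_projPiece`); the union over the exhaustion `compactCovering (T′_f) n` is `projSet γ`.  This is the `hproj`
hypothesis of `suppMeasure_le_of_tProjection`.  Beside it, the DEGENERATE CASE of the display (b) (crit-2 S15417): under
`hDZ : levelTf N ⊆ DZ_f` the right side `ν_f(DZ_f ∩ projSet γ₀)` is positive — `levelTf N ⊆ projSet γ₀` (the fibre at `γ₀`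
contains `1` for `b ∈ K(N)`), open and non-empty (`levelTf_subset_projSet`, `measure_inter_projSet_pos`).

THE DISCHARGE.  With the count bound `hcount : ∃ M, ∀ n, ∃ reps, reps.card ≤ M ∧ K(pⁿ) γ₀,f K(pⁿ) ⊆ ⋃_{g ∈ reps} g K(pⁿ)`
(L4-p2's theorem at `γ₀,f`) and the display (b) `TProjectionComparisonAlong W ν_f γ₀ DZ_f p` (constant `C″ ≠ ⊤`):
* `suppMeasure_le_of_count_of_tProjection`: `suppMeasure (pⁿ) γ ≤ (M C″) · suppMeasure (pⁿ) γ₀` for every `n` and every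
  rational `γ` off the transporter (`suppMeasure_le_of_tProjection` at each `n`);
* `suppMeasure_toReal_le_of_count_of_tProjection`: the same in `ℝ` along `p^(N+n₁)` with `C′ := (M C″).toReal + 1 > 0`, given
  `suppMeasure (p^(N+n₁)) γ₀ ≠ ⊤` (SuppMeasureFinite's `suppMeasure_ne_top`);
* **`suppMeasureFolded_toReal_le_of_count_of_tProjection`** — the glue's `hratio` (x2's
  `exists_levelFamily_fibreDominated_of_displays`, TailGlue S15419) VERBATIM in its binder shape, through the connector
  `suppMeasureFolded ≤ c_conn · suppMeasure` (`c_conn := c ν_∞(T_∞) c′ ν′_∞(T′_∞)`, assumed `≠ ⊤`): `C′ := (c_conn M C″).toReal + 1`;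
* `suppMeasureFolded_toReal_le_of_tProjection`: the same with L4-p2's integrality hypotheses at `γ₀,f` in place of `hcount`;
  `…_of_tProjection'`: the connector finite from `[CompactSpace (torusInf W)] [CompactSpace (torusInf' W)]` (`conn_ne_top`).
So (S-RATIO) is, by name, (S-IDX) in count form + (b) + finiteness of the unit; no binder of its own.

Nothing here says anything about the status of the Hodge conjecture for CM abelian varieties, which is NOT proved
(HC_CM is NOT proved by anyone in this repository).
-/

set_option autoImplicit false
noncomputable section
namespace Summit.Ventures.HodgeRepro.Tier4.Line4
open Summit.Ventures.HodgeRepro.Tier4 Summit.Ventures.HodgeRepro.Tier4.Common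
  Summit.Ventures.HodgeRepro.Tier4.Line1 MeasureTheory NumberField IsDedekindDomain
open scoped Topology Pointwise NNReal ENNReal

section ProjMeasurable
variable {k : Type} [Field k] [NumberField k] (W : PlaneData k) (γ₀ : GA W) (N : ℕ) (γ : GA W)

/-- A piece of the projection set: the `b` whose fibre meets a compact `K ⊆ T′_f` — closed (`N ≠ 0`), being the
coercion-preimage of the compact image of `K ×ˢ (K(N) γ₀,f K(N))` under `(b′, d) ↦ γ_f b′ d⁻¹`. -/
theorem isClosed_projPiece (hN : N ≠ 0) {K : Set (torusFin' W)} (hK : IsCompact K) :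
    IsClosed {b : torusFin W | ∃ b' ∈ K,
      (((b : torusT W) : GA W))⁻¹ * GA.ofFinPart W γ * ((b' : torusT' W) : GA W) ∈
        levelDoubleCoset W N (GA.ofFinPart W γ₀)} := by
  haveI : T2Space (GA W) := t2Space_GA W
  have hDc : IsCompact (levelDoubleCoset W N (GA.ofFinPart W γ₀)) := isCompact_levelDoubleCoset W hN _
  have hφ : Continuous fun p : torusFin' W × GA W =>
      GA.ofFinPart W γ * ((p.1 : torusT' W) : GA W) * p.2⁻¹ :=
    (continuous_const.mul (continuous_subtype_val.comp (continuous_subtype_val.comp continuous_fst))).mul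
      (continuous_inv.comp continuous_snd)
  have himg : IsCompact ((fun p : torusFin' W × GA W => GA.ofFinPart W γ * ((p.1 : torusT' W) : GA W) * p.2⁻¹) ''
      (K ×ˢ levelDoubleCoset W N (GA.ofFinPart W γ₀))) := (hK.prod hDc).image hφ
  have heq : {b : torusFin W | ∃ b' ∈ K,
      (((b : torusT W) : GA W))⁻¹ * GA.ofFinPart W γ * ((b' : torusT' W) : GA W) ∈
        levelDoubleCoset W N (GA.ofFinPart W γ₀)} =
      (fun b : torusFin W => ((b : torusT W) : GA W)) ⁻¹'
        ((fun p : torusFin' W × GA W => GA.ofFinPart W γ * ((p.1 : torusT' W) : GA W) * p.2⁻¹) ''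
          (K ×ˢ levelDoubleCoset W N (GA.ofFinPart W γ₀))) := by
    ext b
    simp only [Set.mem_setOf_eq, Set.mem_preimage, Set.mem_image, Set.mem_prod, Prod.exists]
    constructor
    · rintro ⟨b', hb', hd⟩
      refine ⟨b', _, ⟨hb', hd⟩, ?_⟩
      group
    · rintro ⟨b', d, ⟨hb', hd⟩, hφd⟩
      refine ⟨b', hb', ?_⟩
      rw [← hφd]
      convert hd using 1
      group
  rw [heq]
  exact himg.isClosed.preimage (continuous_subtype_val.comp continuous_subtype_val)

/-- **(β) The projection set is measurable** (`N ≠ 0`): it is `F_σ` — the union, over a compact exhaustion `K_n` of the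
σ-compact `T′_f`, of the closed pieces `{b | ∃ b′ ∈ K_n, b⁻¹ γ_f b′ ∈ K(N) γ₀,f K(N)}`. -/
theorem measurableSet_projSet [MeasurableSpace (GA W)] [BorelSpace (GA W)] (hN : N ≠ 0) :
    MeasurableSet (projSet W γ₀ N γ) := by
  haveI : LocallyCompactSpace (torusFin' W) := locallyCompact_torusFin' W
  haveI : SecondCountableTopology (torusFin' W) := secondCountable_torusFin' W
  haveI : BorelSpace (torusT W) := Subtype.borelSpace _
  haveI : BorelSpace (torusFin W) := Subtype.borelSpace _
  have heq : projSet W γ₀ N γ = ⋃ n : ℕ, {b : torusFin W | ∃ b' ∈ compactCovering (torusFin' W) n,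
      (((b : torusT W) : GA W))⁻¹ * GA.ofFinPart W γ * ((b' : torusT' W) : GA W) ∈
        levelDoubleCoset W N (GA.ofFinPart W γ₀)} := by
    ext b
    simp only [projSet, fibreSet, Set.Nonempty, Set.mem_setOf_eq, Set.mem_iUnion]
    constructor
    · rintro ⟨b', hb'⟩
      obtain ⟨n, hn⟩ := exists_mem_compactCovering b'
      exact ⟨n, b', hn, hb'⟩
    · rintro ⟨n, b', -, hb'⟩
      exact ⟨b', hb'⟩
  rw [heq]
  exact MeasurableSet.iUnion fun n =>
    (isClosed_projPiece W γ₀ N γ hN (isCompact_compactCovering (torusFin' W) n)).measurableSet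

end ProjMeasurable

section Degenerate
variable {k : Type} [Field k] [NumberField k] (W : PlaneData k) (γ₀ : GA W) (N : ℕ)

/-- `levelTf N ⊆ projSet γ₀`: for `b ∈ T_f ∩ K(N)` the fibre at `γ₀` contains `1` (`b⁻¹ γ₀,f ∈ K(N) γ₀,f K(N)`). -/
theorem levelTf_subset_projSet : levelTf W N ⊆ projSet W γ₀ N γ₀ := by
  intro b hb
  refine ⟨1, ?_⟩
  show (((b : torusT W) : GA W))⁻¹ * GA.ofFinPart W γ₀ * (((1 : torusFin' W) : torusT' W) : GA W) ∈
    levelDoubleCoset W N (GA.ofFinPart W γ₀)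
  exact Set.mul_mem_mul (Set.mul_mem_mul (SetLike.mem_coe.2 ((levelK W N).inv_mem hb)) (Set.mem_singleton _))
    (one_mem_levelTf' W N)

/-- **The right side of the projection comparison is never degenerate under `hDZ`**: if `levelTf N ⊆ DZ_f` (`N ≠ 0`), then
`0 < ν_f(DZ_f ∩ projSet γ₀)` — it contains the open non-empty `levelTf N`. -/
theorem measure_inter_projSet_pos [MeasurableSpace (GA W)] [BorelSpace (GA W)] (νf : Measure (torusFin W))
    [νf.IsHaarMeasure] (DZf : Set (torusFin W)) (hN : N ≠ 0) (hDZ : levelTf W N ⊆ DZf) :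
    0 < νf (DZf ∩ projSet W γ₀ N γ₀) := by
  haveI : BorelSpace (torusT W) := Subtype.borelSpace _
  haveI : BorelSpace (torusFin W) := Subtype.borelSpace _
  refine lt_of_lt_of_le ((isOpen_levelTf W hN).measure_pos νf ⟨1, one_mem_levelTf W N⟩) (measure_mono ?_)
  exact Set.subset_inter hDZ (levelTf_subset_projSet W γ₀ N)

end Degenerate

section Discharge
variable {k : Type} [Field k] [NumberField k] (W : PlaneData k) [MeasurableSpace (GA W)] [BorelSpace (GA W)]
  (νf : Measure (torusFin W)) (νf' : Measure (torusFin' W)) (γ₀ : GA W) (DZf : Set (torusFin W))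

/-- **(S-RATIO) along `pⁿ`, in `ℝ≥0∞`**: from the count bound and the `T_f`-projection comparison,
`suppMeasure (pⁿ) γ ≤ (M C″) · suppMeasure (pⁿ) γ₀` for every `n` and every rational `γ` off the transporter. -/
theorem suppMeasure_le_of_count_of_tProjection [νf.IsHaarMeasure] [νf'.IsHaarMeasure] (hDZf : MeasurableSet DZf)
    {p : ℕ} (hp : p ≠ 0)
    (hcount : ∃ M : ℕ, ∀ n : ℕ, ∃ reps : Finset (GA W), reps.card ≤ M ∧
      levelDoubleCoset W (p ^ n) (GA.ofFinPart W γ₀) ⊆ ⋃ g ∈ reps, g • (levelK W (p ^ n) : Set (GA W)))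
    (hT : TProjectionComparisonAlong W νf γ₀ DZf p) :
    ∃ C' : ℝ≥0∞, C' ≠ ⊤ ∧ ∀ (n : ℕ) (γ : rationalPoints W),
      (torusT W).map (MulAut.conj ((γ : GA W))⁻¹).toMonoidHom ≠ torusT' W →
      suppMeasure W νf νf' γ₀ DZf (p ^ n) (γ : GA W) ≤ C' * suppMeasure W νf νf' γ₀ DZf (p ^ n) γ₀ := by
  obtain ⟨M, hM⟩ := hcount
  obtain ⟨C'', hC''top, hC''⟩ := hT
  refine ⟨(M : ℝ≥0∞) * C'', ENNReal.mul_ne_top (ENNReal.natCast_ne_top M) hC''top, fun n γ hγ => ?_⟩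
  obtain ⟨reps, hcard, hcov⟩ := hM n
  have hN : p ^ n ≠ 0 := pow_ne_zero n hp
  calc suppMeasure W νf νf' γ₀ DZf (p ^ n) (γ : GA W)
      ≤ ((reps.card : ℝ≥0∞) * C'') * suppMeasure W νf νf' γ₀ DZf (p ^ n) γ₀ :=
        suppMeasure_le_of_tProjection W νf νf' γ₀ DZf (p ^ n) (γ : GA W) hN hDZf
          (measurableSet_projSet W γ₀ (p ^ n) γ₀ hN) reps hcov C'' (hC'' n γ hγ)
    _ ≤ ((M : ℝ≥0∞) * C'') * suppMeasure W νf νf' γ₀ DZf (p ^ n) γ₀ := by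
        gcongr

/-- **(S-RATIO) along `p^(N+n₁)`, in `ℝ`**: `(suppMeasure γ).toReal ≤ C′ · (suppMeasure γ₀).toReal` with `0 < C′`, given the
unit is finite at every level. -/
theorem suppMeasure_toReal_le_of_count_of_tProjection [νf.IsHaarMeasure] [νf'.IsHaarMeasure]
    (hDZf : MeasurableSet DZf) {p : ℕ} (hp : p ≠ 0) (n₁ : ℕ)
    (hcount : ∃ M : ℕ, ∀ n : ℕ, ∃ reps : Finset (GA W), reps.card ≤ M ∧
      levelDoubleCoset W (p ^ n) (GA.ofFinPart W γ₀) ⊆ ⋃ g ∈ reps, g • (levelK W (p ^ n) : Set (GA W)))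
    (hT : TProjectionComparisonAlong W νf γ₀ DZf p)
    (hfin : ∀ N : ℕ, suppMeasure W νf νf' γ₀ DZf (p ^ (N + n₁)) γ₀ ≠ ⊤) :
    ∃ C' : ℝ, 0 < C' ∧ ∀ (N : ℕ) (γ : rationalPoints W),
      ¬ ((torusT W).map (MulAut.conj ((γ : GA W))⁻¹).toMonoidHom = torusT' W) →
      (suppMeasure W νf νf' γ₀ DZf (p ^ (N + n₁)) (γ : GA W)).toReal ≤
        C' * (suppMeasure W νf νf' γ₀ DZf (p ^ (N + n₁)) γ₀).toReal := by
  obtain ⟨C', hC'top, hC'⟩ := suppMeasure_le_of_count_of_tProjection W νf νf' γ₀ DZf hDZf hp hcount hT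
  refine ⟨C'.toReal + 1, by positivity, fun N γ hγ => ?_⟩
  have h := ENNReal.toReal_mono (ENNReal.mul_ne_top hC'top (hfin N)) (hC' (N + n₁) γ hγ)
  rw [ENNReal.toReal_mul] at h
  refine h.trans (mul_le_mul_of_nonneg_right ?_ ENNReal.toReal_nonneg)
  linarith

end Discharge

section Folded
variable {k : Type} [Field k] [NumberField k] (W : PlaneData k) [MeasurableSpace (GA W)] [BorelSpace (GA W)]
  (R : RTFData W)

/-- **The glue's `hratio`, by name modulo the display (b)**: for the chain data of HorbMain / FoldedUnfolded (`hc`, `hc′`,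
`hDZf`, `hfd`) with a finite connector constant `c ν_∞(T_∞) c′ ν′_∞(T′_∞) ≠ ⊤`, the count bound along `pⁿ` at `γ₀,f`, the
`T_f`-projection comparison along `p`, and finiteness of the unit: there is `C′ > 0` with
`(suppMeasureFolded (p^(N+n₁)) γ).toReal ≤ C′ · (suppMeasure (p^(N+n₁)) γ₀).toReal` for every `N` and every rational `γ`
off the transporter — the binder `hratio` of `exists_levelFamily_fibreDominated_of_displays` (TailGlue). -/
theorem suppMeasureFolded_toReal_le_of_count_of_tProjection [MeasurableMul (torusT W)] [MeasurableMul (torusT' W)]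
    (hR : R.IsHaar) (νinf : Measure (torusInf W)) [νinf.IsHaarMeasure] (νf : Measure (torusFin W))
    [νf.IsHaarMeasure] (c : ℝ≥0) (hc : R.μT = c • Measure.map (torusSplit W).symm (νinf.prod νf))
    (νinf' : Measure (torusInf' W)) [νinf'.IsHaarMeasure] (νf' : Measure (torusFin' W)) [νf'.IsHaarMeasure]
    (c' : ℝ≥0) (hc' : R.μT' = c' • Measure.map (torusSplit' W).symm (νinf'.prod νf'))
    (hconn : (c : ℝ≥0∞) * νinf Set.univ * ((c' : ℝ≥0∞) * νinf' Set.univ) ≠ ⊤)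
    (DZf : Set (torusFin W)) (hDZf : MeasurableSet DZf) (hfd : IsFundamentalDomain (centreFin W) DZf νf)
    (γ₀ : GA W) {p : ℕ} (hp : p ≠ 0) (n₁ : ℕ)
    (hcount : ∃ M : ℕ, ∀ n : ℕ, ∃ reps : Finset (GA W), reps.card ≤ M ∧
      levelDoubleCoset W (p ^ n) (GA.ofFinPart W γ₀) ⊆ ⋃ g ∈ reps, g • (levelK W (p ^ n) : Set (GA W)))
    (hT : TProjectionComparisonAlong W νf γ₀ DZf p)
    (hfin : ∀ N : ℕ, suppMeasure W νf νf' γ₀ DZf (p ^ (N + n₁)) γ₀ ≠ ⊤) :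
    ∃ C' : ℝ, 0 < C' ∧ ∀ (N : ℕ) (γ : rationalPoints W),
      ¬ ((torusT W).map (MulAut.conj ((γ : GA W))⁻¹).toMonoidHom = torusT' W) →
      (suppMeasureFolded W R γ₀ (p ^ (N + n₁)) (γ : GA W)).toReal ≤
        C' * (suppMeasure W νf νf' γ₀ DZf (p ^ (N + n₁)) γ₀).toReal := by
  obtain ⟨C', hC'top, hC'⟩ := suppMeasure_le_of_count_of_tProjection W νf νf' γ₀ DZf hDZf hp hcount hT
  set cc : ℝ≥0∞ := (c : ℝ≥0∞) * νinf Set.univ * ((c' : ℝ≥0∞) * νinf' Set.univ) with hcc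
  refine ⟨(cc * C').toReal + 1, by positivity, fun N γ hγ => ?_⟩
  have hN : p ^ (N + n₁) ≠ 0 := pow_ne_zero _ hp
  have h1 : suppMeasureFolded W R γ₀ (p ^ (N + n₁)) (γ : GA W) ≤
      (cc * C') * suppMeasure W νf νf' γ₀ DZf (p ^ (N + n₁)) γ₀ := by
    calc suppMeasureFolded W R γ₀ (p ^ (N + n₁)) (γ : GA W)
        ≤ cc * suppMeasure W νf νf' γ₀ DZf (p ^ (N + n₁)) (γ : GA W) :=
          suppMeasureFolded_le_suppMeasure W R hR νinf νf c hc νinf' νf' c' hc' DZf hDZf hfd γ₀ hN (γ : GA W)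
      _ ≤ cc * (C' * suppMeasure W νf νf' γ₀ DZf (p ^ (N + n₁)) γ₀) := by gcongr; exact hC' (N + n₁) γ hγ
      _ = (cc * C') * suppMeasure W νf νf' γ₀ DZf (p ^ (N + n₁)) γ₀ := (mul_assoc cc C' _).symm
  have h := ENNReal.toReal_mono (ENNReal.mul_ne_top (ENNReal.mul_ne_top hconn hC'top) (hfin N)) h1
  rw [ENNReal.toReal_mul] at h
  refine h.trans (mul_le_mul_of_nonneg_right ?_ ENNReal.toReal_nonneg)
  linarith

/-- The same with L4-p2's count-form index bound instantiated: `γ₀,f` integral with integral inverse at the places above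
`p` (the hypotheses of `exists_finset_cover_levelDoubleCoset`, LevelIndexCount) in place of `hcount`. -/
theorem suppMeasureFolded_toReal_le_of_tProjection [MeasurableMul (torusT W)] [MeasurableMul (torusT' W)]
    (hR : R.IsHaar) (νinf : Measure (torusInf W)) [νinf.IsHaarMeasure] (νf : Measure (torusFin W))
    [νf.IsHaarMeasure] (c : ℝ≥0) (hc : R.μT = c • Measure.map (torusSplit W).symm (νinf.prod νf))
    (νinf' : Measure (torusInf' W)) [νinf'.IsHaarMeasure] (νf' : Measure (torusFin' W)) [νf'.IsHaarMeasure]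
    (c' : ℝ≥0) (hc' : R.μT' = c' • Measure.map (torusSplit' W).symm (νinf'.prod νf'))
    (hconn : (c : ℝ≥0∞) * νinf Set.univ * ((c' : ℝ≥0∞) * νinf' Set.univ) ≠ ⊤)
    (DZf : Set (torusFin W)) (hDZf : MeasurableSet DZf) (hfd : IsFundamentalDomain (centreFin W) DZf νf)
    (γ₀ : GA W) {p : ℕ} (hp : p ≠ 0) (n₁ : ℕ)
    (hγ₀ : ∀ v : HeightOneSpectrum (𝓞 k), (p : 𝓞 k) ∈ v.asIdeal → ∀ i j,
      Valued.v (finPart k (GA.mat W (GA.ofFinPart W γ₀) i j) v) ≤ 1)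
    (hγ₀' : ∀ v : HeightOneSpectrum (𝓞 k), (p : 𝓞 k) ∈ v.asIdeal → ∀ i j,
      Valued.v (finPart k (GA.mat W (GA.ofFinPart W γ₀)⁻¹ i j) v) ≤ 1)
    (hT : TProjectionComparisonAlong W νf γ₀ DZf p)
    (hfin : ∀ N : ℕ, suppMeasure W νf νf' γ₀ DZf (p ^ (N + n₁)) γ₀ ≠ ⊤) :
    ∃ C' : ℝ, 0 < C' ∧ ∀ (N : ℕ) (γ : rationalPoints W),
      ¬ ((torusT W).map (MulAut.conj ((γ : GA W))⁻¹).toMonoidHom = torusT' W) →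
      (suppMeasureFolded W R γ₀ (p ^ (N + n₁)) (γ : GA W)).toReal ≤
        C' * (suppMeasure W νf νf' γ₀ DZf (p ^ (N + n₁)) γ₀).toReal :=
  suppMeasureFolded_toReal_le_of_count_of_tProjection W R hR νinf νf c hc νinf' νf' c' hc' hconn DZf hDZf hfd γ₀
    hp n₁ (exists_finset_cover_levelDoubleCoset W (ofFinPart_mem_finitePart' W γ₀) p hγ₀ hγ₀') hT hfin

omit [BorelSpace (GA W)] in
/-- The connector constant is finite when both archimedean tori are compact (`IsFiniteMeasureOnCompacts`). -/
theorem conn_ne_top [CompactSpace (torusInf W)] [CompactSpace (torusInf' W)]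
    (νinf : Measure (torusInf W)) [νinf.IsHaarMeasure] (νinf' : Measure (torusInf' W)) [νinf'.IsHaarMeasure]
    (c c' : ℝ≥0) : (c : ℝ≥0∞) * νinf Set.univ * ((c' : ℝ≥0∞) * νinf' Set.univ) ≠ ⊤ :=
  ENNReal.mul_ne_top (ENNReal.mul_ne_top ENNReal.coe_ne_top (measure_ne_top νinf _))
    (ENNReal.mul_ne_top ENNReal.coe_ne_top (measure_ne_top νinf' _))

/-- `suppMeasureFolded_toReal_le_of_tProjection` with the connector's finiteness from the compactness of the archimedean
tori. -/
theorem suppMeasureFolded_toReal_le_of_tProjection' [MeasurableMul (torusT W)] [MeasurableMul (torusT' W)]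
    [CompactSpace (torusInf W)] [CompactSpace (torusInf' W)]
    (hR : R.IsHaar) (νinf : Measure (torusInf W)) [νinf.IsHaarMeasure] (νf : Measure (torusFin W))
    [νf.IsHaarMeasure] (c : ℝ≥0) (hc : R.μT = c • Measure.map (torusSplit W).symm (νinf.prod νf))
    (νinf' : Measure (torusInf' W)) [νinf'.IsHaarMeasure] (νf' : Measure (torusFin' W)) [νf'.IsHaarMeasure]
    (c' : ℝ≥0) (hc' : R.μT' = c' • Measure.map (torusSplit' W).symm (νinf'.prod νf'))
    (DZf : Set (torusFin W)) (hDZf : MeasurableSet DZf) (hfd : IsFundamentalDomain (centreFin W) DZf νf)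
    (γ₀ : GA W) {p : ℕ} (hp : p ≠ 0) (n₁ : ℕ)
    (hγ₀ : ∀ v : HeightOneSpectrum (𝓞 k), (p : 𝓞 k) ∈ v.asIdeal → ∀ i j,
      Valued.v (finPart k (GA.mat W (GA.ofFinPart W γ₀) i j) v) ≤ 1)
    (hγ₀' : ∀ v : HeightOneSpectrum (𝓞 k), (p : 𝓞 k) ∈ v.asIdeal → ∀ i j,
      Valued.v (finPart k (GA.mat W (GA.ofFinPart W γ₀)⁻¹ i j) v) ≤ 1)
    (hT : TProjectionComparisonAlong W νf γ₀ DZf p)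
    (hfin : ∀ N : ℕ, suppMeasure W νf νf' γ₀ DZf (p ^ (N + n₁)) γ₀ ≠ ⊤) :
    ∃ C' : ℝ, 0 < C' ∧ ∀ (N : ℕ) (γ : rationalPoints W),
      ¬ ((torusT W).map (MulAut.conj ((γ : GA W))⁻¹).toMonoidHom = torusT' W) →
      (suppMeasureFolded W R γ₀ (p ^ (N + n₁)) (γ : GA W)).toReal ≤
        C' * (suppMeasure W νf νf' γ₀ DZf (p ^ (N + n₁)) γ₀).toReal :=
  suppMeasureFolded_toReal_le_of_tProjection W R hR νinf νf c hc νinf' νf' c' hc' (conn_ne_top W νinf νinf' c c')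
    DZf hDZf hfd γ₀ hp n₁ hγ₀ hγ₀' hT hfin

end Folded

end Summit.Ventures.HodgeRepro.Tier4.Line4

end
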